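import Summits.CriticalPhenomena.PercolationContinuityZ3.Theses.PercMinContact
import Literature.Probability.Percolation.BondPercolationSymmetry
import Literature.Probability.Percolation.TwoGhostInequalityProofs
import Literature.Probability.Percolation.SlabCriticalityInputs

/-!
# Route `PercMinContact`, item `LogMomentConverse` (stmt-CriticalPhenomena-11501) — part 1:
# the transport / reflection bound on the min-contact function

Def-free helper lemmas (general dimension `d`) for the proof of
`Summit.CriticalPhenomena.PercolationContinuityZ3.Theses.PercMinContact.LogMomentConverse`.
Writing `C(x) = openCluster ω x`, `|C(x)| ∈ ℝ≥0∞` for `↑(openCluster ω x).encard`, `N(b)` for the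
neighbours of `b` in `ℤ^d` and `P_p = bondPercolation (zdGraph d) p`, this file proves the first step of
the item's paper proof (card C3 of the route), `lintegral_minContact_le_tsum`:
`m(p) := E_p[Σ_{y ∈ N(0)} 1{0 ↮ y} min(|C(0)|, |C(y)|)] ≤ 2 Σ'_b Σ_{y ∈ N(b)} P_p(A_{b,y})`, where
`A_{b,y} = {b ∈ C(0), y ∉ C(0), |C(0)| ≤ |C(y)|}` is the event "the directed lattice edge `(b, y)`
leaves `C(0)` towards a cluster at least as large". Ingredients:

* the kernel bound `min(a, b) ≤ a·1{a ≤ b} + b·1{b ≤ a}` (`indicator_min_le_kernel_add`);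
* the point reflection `x ↦ y - x`, a graph automorphism of `ℤ^d` swapping `0` and `y`, under which
  `P_p` is invariant (`bondPercolation_map_relabel_iso`), exchanging the two kernel terms
  (`lintegral_kernel_swap`);
* the mass-transport principle for the translation group of `ℤ^d` (`lintegral_tsum_mtp`, from
  `bondPercolation_map_shift`), applied to the transport `F(a, b; ω) = 1{a ∈ C(b)} h(ω, b)`,
  `h(ω, b) = Σ_{y ∈ N(b)} 1{y ∉ C(b), |C(b)| ≤ |C(y)|}`, which turns `E[|C(0)| h(ω, 0)]` into
  `E[Σ_{b ∈ C(0)} h(ω, b)] = Σ'_b Σ_{y ∈ N(b)} P_p(A_{b,y})`.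

Also: measurability of clusters / cluster sizes, and `A_{b,y} ⊆ {ω | ω \ {s(b,y)} ∈ A_{b,y}}` (on `A_{b,y}`
the edge `s(b, y)` is closed). References: the route's card C3; Grimmett 1999 §1.6 (lattice symmetries
of `P_p`); Lyons–Peres 2016 §8.1 (mass transport on transitive graphs).
-/

noncomputable section

namespace Summit.CriticalPhenomena.PercolationContinuityZ3.Theorems

namespace PercMinContactLMC

open MeasureTheory Literature.Probability.Percolation Literature.Probability.LatticeModels
open scoped ENNReal

variable {d : ℕ}

/-! ### Measurability of clusters and cluster sizes -/

/-- The open cluster of `x`, as a `Set`-valued function of the configuration, is measurable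
(each membership event is `{x ↔ y}`, `measurableSet_openConn_holds`). [folklore] -/
theorem measurable_openCluster {V : Type*} [Countable V] (x : V) :
    Measurable fun ω : BondConfig V => openCluster ω x :=
  measurable_set_iff.2 fun y => measurableSet_setOf.1 (measurableSet_openConn_holds x y)

/-- The cluster size `|C(x)| ∈ ℝ≥0∞` is a measurable function of the configuration. [folklore] -/
theorem measurable_encard_openCluster {V : Type*} [Countable V] (x : V) :
    Measurable fun ω : BondConfig V => ((openCluster ω x).encard : ℝ≥0∞) :=
  (Measurable.of_discrete (f := fun n : ℕ∞ => (n : ℝ≥0∞))).comp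
    (measurable_encard.comp (measurable_openCluster x))

/-- The event `{y ∉ C(x), |C(x)| ≤ |C(y)|}` is measurable. [folklore] -/
theorem measurableSet_notMem_and_le {V : Type*} [Countable V] (x y : V) :
    MeasurableSet {ω : BondConfig V | y ∉ openCluster ω x ∧
      ((openCluster ω x).encard : ℝ≥0∞) ≤ (openCluster ω y).encard} :=
  (measurableSet_openConn_holds x y).compl.inter
    (measurableSet_le (measurable_encard_openCluster x) (measurable_encard_openCluster y))

/-- The swallow-candidate event `A_{b,y} = {b ∈ C(0), y ∉ C(0), |C(0)| ≤ |C(y)|}` is measurable.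
[folklore] -/
theorem measurableSet_swallowEvt {V : Type*} [Countable V] [Zero V] (b y : V) :
    MeasurableSet {ω : BondConfig V | b ∈ openCluster ω 0 ∧ y ∉ openCluster ω 0 ∧
      ((openCluster ω 0).encard : ℝ≥0∞) ≤ (openCluster ω y).encard} :=
  (measurableSet_openConn_holds 0 b).inter (measurableSet_notMem_and_le 0 y)

/-! ### The kernel bound -/

/-- **Kernel bound** `1{0 ↮ y} min(|C(0)|, |C(y)|) ≤ T(0, y) + T(y, 0)` with
`T(x, y) = 1{y ∉ C(x), |C(x)| ≤ |C(y)|} |C(x)|` (from `min(a,b) ≤ a 1{a ≤ b} + b 1{b ≤ a}`). [folklore] -/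
theorem indicator_min_le_kernel_add {V : Type*} (ω : BondConfig V) (x y : V) :
    (openConn x y)ᶜ.indicator
        (fun ω => min ((openCluster ω x).encard : ℝ≥0∞) ((openCluster ω y).encard : ℝ≥0∞)) ω ≤
      {ω : BondConfig V | y ∉ openCluster ω x ∧
          ((openCluster ω x).encard : ℝ≥0∞) ≤ (openCluster ω y).encard}.indicator
          (fun ω => ((openCluster ω x).encard : ℝ≥0∞)) ω +
        {ω : BondConfig V | x ∉ openCluster ω y ∧
          ((openCluster ω y).encard : ℝ≥0∞) ≤ (openCluster ω x).encard}.indicator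
          (fun ω => ((openCluster ω y).encard : ℝ≥0∞)) ω := by
  by_cases h : ω ∈ openConn x y
  · rw [Set.indicator_of_notMem (Set.notMem_compl_iff.2 h)]
    exact zero_le
  · rw [Set.indicator_of_mem (Set.mem_compl h)]
    have hyx : y ∉ openCluster ω x := h
    have hxy : x ∉ openCluster ω y := fun h' => h (SimpleGraph.Reachable.symm h')
    by_cases hle : ((openCluster ω x).encard : ℝ≥0∞) ≤ (openCluster ω y).encard
    · have hmem : ω ∈ {ω : BondConfig V | y ∉ openCluster ω x ∧
          ((openCluster ω x).encard : ℝ≥0∞) ≤ (openCluster ω y).encard} := ⟨hyx, hle⟩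
      rw [min_eq_left hle, Set.indicator_of_mem hmem]
      exact le_self_add
    · have hle' : ((openCluster ω y).encard : ℝ≥0∞) ≤ (openCluster ω x).encard := (not_le.1 hle).le
      have hmem : ω ∈ {ω : BondConfig V | x ∉ openCluster ω y ∧
          ((openCluster ω y).encard : ℝ≥0∞) ≤ (openCluster ω x).encard} := ⟨hxy, hle'⟩
      rw [min_eq_right hle', Set.indicator_of_mem hmem]
      exact le_add_self

/-! ### The point reflection `x ↦ y - x` of `ℤ^d` -/

/-- Transport of clusters, cluster sizes and the kernel `T` along a bijection `φ` of the vertices: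
`T(φ·ω; φ x, φ y) = T(ω; x, y)`. [folklore] -/
theorem kernel_relabel {V W : Type*} (φ : V ≃ W) (ω : BondConfig V) (x y : V) :
    {ω' : BondConfig W | φ y ∉ openCluster ω' (φ x) ∧
        ((openCluster ω' (φ x)).encard : ℝ≥0∞) ≤ (openCluster ω' (φ y)).encard}.indicator
        (fun ω' => ((openCluster ω' (φ x)).encard : ℝ≥0∞)) (BondConfig.relabel (sym2Equiv φ) ω) =
      {ω : BondConfig V | y ∉ openCluster ω x ∧
        ((openCluster ω x).encard : ℝ≥0∞) ≤ (openCluster ω y).encard}.indicator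
        (fun ω => ((openCluster ω x).encard : ℝ≥0∞)) ω := by
  classical
  simp only [Set.indicator_apply, Set.mem_setOf_eq, openCluster_relabel, φ.injective.encard_image,
    Set.mem_image_equiv, Equiv.symm_apply_apply]

/-- **Reflection symmetry of the kernel**: `E_p[T(y, 0)] = E_p[T(0, y)]`, by the point reflection
`x ↦ y - x` (a graph automorphism of `ℤ^d` exchanging `0` and `y`, under which `P_p` is invariant,
`bondPercolation_map_relabel_iso`). [folklore] -/
theorem lintegral_kernel_swap (p : unitInterval) (y : Site d) :
    ∫⁻ ω, {ω : BondConfig (Site d) | (0 : Site d) ∉ openCluster ω y ∧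
        ((openCluster ω y).encard : ℝ≥0∞) ≤ (openCluster ω 0).encard}.indicator
        (fun ω => ((openCluster ω y).encard : ℝ≥0∞)) ω ∂(bondPercolation (zdGraph d) p) =
      ∫⁻ ω, {ω : BondConfig (Site d) | y ∉ openCluster ω 0 ∧
        ((openCluster ω 0).encard : ℝ≥0∞) ≤ (openCluster ω y).encard}.indicator
        (fun ω => ((openCluster ω 0).encard : ℝ≥0∞)) ω ∂(bondPercolation (zdGraph d) p) := by
  -- the reflection `ρ x = y - x`, an involutive graph automorphism of `ℤ^d`
  let ρ : Site d ≃ Site d :=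
    { toFun := fun x => y - x
      invFun := fun x => y - x
      left_inv := fun x => sub_sub_cancel y x
      right_inv := fun x => sub_sub_cancel y x }
  have hadj : ∀ a b : Site d, (zdGraph d).Adj (ρ a) (ρ b) ↔ (zdGraph d).Adj a b := by
    intro a b
    change (zdGraph d).Adj (y - a) (y - b) ↔ (zdGraph d).Adj a b
    rw [zdGraph_adj_iff, zdGraph_adj_iff]
    constructor
    · rintro ⟨i, h | h⟩
      · exact ⟨i, Or.inr (by linear_combination h)⟩
      · exact ⟨i, Or.inl (by linear_combination h)⟩
    · rintro ⟨i, h | h⟩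
      · exact ⟨i, Or.inr (by linear_combination h)⟩
      · exact ⟨i, Or.inl (by linear_combination h)⟩
  let ρiso : zdGraph d ≃g zdGraph d := { toEquiv := ρ, map_rel_iff' := fun {a b} => hadj a b }
  have hmap : (bondPercolation (zdGraph d) p).map (BondConfig.relabel (sym2Equiv ρ)) =
      bondPercolation (zdGraph d) p := bondPercolation_map_relabel_iso ρiso p
  have hρ0 : ρ 0 = y := sub_zero y
  have hρy : ρ y = 0 := sub_self y
  calc _ = ∫⁻ ω, {ω : BondConfig (Site d) | (0 : Site d) ∉ openCluster ω y ∧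
        ((openCluster ω y).encard : ℝ≥0∞) ≤ (openCluster ω 0).encard}.indicator
        (fun ω => ((openCluster ω y).encard : ℝ≥0∞)) ω
          ∂((bondPercolation (zdGraph d) p).map (BondConfig.relabel (sym2Equiv ρ))) := by
        rw [hmap]
    _ = ∫⁻ ω, {ω : BondConfig (Site d) | (0 : Site d) ∉ openCluster ω y ∧
        ((openCluster ω y).encard : ℝ≥0∞) ≤ (openCluster ω 0).encard}.indicator
        (fun ω => ((openCluster ω y).encard : ℝ≥0∞)) (BondConfig.relabel (sym2Equiv ρ) ω)
          ∂(bondPercolation (zdGraph d) p) := lintegral_map_equiv _ _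
    _ = _ := by
        refine lintegral_congr fun ω => ?_
        have h := kernel_relabel ρ ω 0 y
        rw [hρ0, hρy] at h
        exact h

/-! ### The mass-transport principle for translations of `ℤ^d` -/

/-- **Mass-transport principle on `ℤ^d`** (translation group, which is unimodular): for a measurable,
diagonally translation-invariant random transport `F(a, b; ω) ∈ [0, ∞]`,
`E_p Σ'_b F(0, b) = E_p Σ'_a F(a, 0)`. [folklore] -/
theorem lintegral_tsum_mtp (p : unitInterval) (F : Site d → Site d → BondConfig (Site d) → ℝ≥0∞)
    (hF : ∀ a b, Measurable (F a b))
    (hinv : ∀ (a b v : Site d) (ω : BondConfig (Site d)),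
      F (a + v) (b + v) (BondConfig.relabel (sym2Equiv (Site.shift v)) ω) = F a b ω) :
    ∫⁻ ω, ∑' b, F 0 b ω ∂(bondPercolation (zdGraph d) p) =
      ∫⁻ ω, ∑' a, F a 0 ω ∂(bondPercolation (zdGraph d) p) := by
  rw [lintegral_tsum fun b => (hF 0 b).aemeasurable, lintegral_tsum fun a => (hF a 0).aemeasurable]
  have hterm : ∀ b : Site d, ∫⁻ ω, F 0 b ω ∂(bondPercolation (zdGraph d) p) =
      ∫⁻ ω, F (-b) 0 ω ∂(bondPercolation (zdGraph d) p) := by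
    intro b
    calc ∫⁻ ω, F 0 b ω ∂(bondPercolation (zdGraph d) p)
        = ∫⁻ ω, F 0 b ω ∂((bondPercolation (zdGraph d) p).map
            (BondConfig.relabel (sym2Equiv (Site.shift b)))) := by rw [bondPercolation_map_shift]
      _ = ∫⁻ ω, F 0 b (BondConfig.relabel (sym2Equiv (Site.shift b)) ω)
            ∂(bondPercolation (zdGraph d) p) := lintegral_map_equiv _ _
      _ = ∫⁻ ω, F (-b) 0 ω ∂(bondPercolation (zdGraph d) p) := by
          refine lintegral_congr fun ω => ?_
          have h := hinv (-b) 0 b ω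
          rwa [neg_add_cancel, zero_add] at h
  simp_rw [hterm]
  exact (Equiv.neg (Site d)).tsum_eq fun a => ∫⁻ ω, F a 0 ω ∂(bondPercolation (zdGraph d) p)

/-! ### The transport `F(a, b; ω) = 1{a ∈ C(b)} h(ω, b)` -/

/-- Sums over the neighbours of a translate: `Σ_{y ∈ N(b + v)} f(y) = Σ_{y ∈ N(b)} f(y + v)`. [folklore] -/
theorem sum_neighborFinset_shift (b v : Site d) (f : Site d → ℝ≥0∞) :
    ∑ y ∈ (zdGraph d).neighborFinset (b + v), f y = ∑ y ∈ (zdGraph d).neighborFinset b, f (y + v) := by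
  symm
  refine Finset.sum_equiv (Equiv.addRight v) (fun y => ?_) (fun y _ => rfl)
  rw [SimpleGraph.mem_neighborFinset, SimpleGraph.mem_neighborFinset, Equiv.coe_addRight]
  exact (zdGraph_adj_shift_iff v b y).symm

/-- Measurability of `h(ω, b) = Σ_{y ∈ N(b)} 1{y ∉ C(b), |C(b)| ≤ |C(y)|}`. [folklore] -/
theorem measurable_hsum (b : Site d) :
    Measurable fun ω : BondConfig (Site d) => ∑ y ∈ (zdGraph d).neighborFinset b,
      {ω : BondConfig (Site d) | y ∉ openCluster ω b ∧
        ((openCluster ω b).encard : ℝ≥0∞) ≤ (openCluster ω y).encard}.indicator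
        (fun _ => (1 : ℝ≥0∞)) ω :=
  Finset.measurable_sum _ fun y _ => (measurable_const.indicator (measurableSet_notMem_and_le b y))

/-- Measurability of `ω ↦ 1{a ∈ C(b)}`. [folklore] -/
theorem measurable_indicator_mem_openCluster (a b : Site d) :
    Measurable fun ω : BondConfig (Site d) => (openCluster ω b).indicator (fun _ => (1 : ℝ≥0∞)) a := by
  classical
  simp_rw [Set.indicator_apply]
  exact Measurable.ite (measurableSet_openConn_holds b a) measurable_const measurable_const

/-- Measurability of the transport `F(a, b; ω) = 1{a ∈ C(b)} h(ω, b)`. [folklore] -/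
theorem measurable_transport (a b : Site d) :
    Measurable fun ω : BondConfig (Site d) => (openCluster ω b).indicator (fun _ => (1 : ℝ≥0∞)) a *
      ∑ y ∈ (zdGraph d).neighborFinset b,
        {ω : BondConfig (Site d) | y ∉ openCluster ω b ∧
          ((openCluster ω b).encard : ℝ≥0∞) ≤ (openCluster ω y).encard}.indicator
          (fun _ => (1 : ℝ≥0∞)) ω :=
  (measurable_indicator_mem_openCluster a b).mul (measurable_hsum b)

/-- Diagonal translation invariance of the transport: clusters, cluster sizes and neighbourhoods are
translated by the shift `ω ↦ ω + v` (`openCluster_relabel_shift`). [folklore] -/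
theorem transport_shift (a b v : Site d) (ω : BondConfig (Site d)) :
    (openCluster (BondConfig.relabel (sym2Equiv (Site.shift v)) ω) (b + v)).indicator
        (fun _ => (1 : ℝ≥0∞)) (a + v) *
      ∑ y ∈ (zdGraph d).neighborFinset (b + v),
        {ω' : BondConfig (Site d) | y ∉ openCluster ω' (b + v) ∧
          ((openCluster ω' (b + v)).encard : ℝ≥0∞) ≤ (openCluster ω' y).encard}.indicator
          (fun _ => (1 : ℝ≥0∞)) (BondConfig.relabel (sym2Equiv (Site.shift v)) ω) =
    (openCluster ω b).indicator (fun _ => (1 : ℝ≥0∞)) a *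
      ∑ y ∈ (zdGraph d).neighborFinset b,
        {ω : BondConfig (Site d) | y ∉ openCluster ω b ∧
          ((openCluster ω b).encard : ℝ≥0∞) ≤ (openCluster ω y).encard}.indicator
          (fun _ => (1 : ℝ≥0∞)) ω := by
  classical
  have hinj : Function.Injective fun x : Site d => x + v := add_left_injective v
  have hC : ∀ x z : Site d, z + v ∈ openCluster (BondConfig.relabel (sym2Equiv (Site.shift v)) ω) (x + v) ↔
      z ∈ openCluster ω x := by
    intro x z
    rw [openCluster_relabel_shift v ω x]
    exact ⟨fun ⟨w, hw, h⟩ => hinj h ▸ hw, fun h => ⟨z, h, rfl⟩⟩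
  have hE : ∀ x : Site d, (openCluster (BondConfig.relabel (sym2Equiv (Site.shift v)) ω) (x + v)).encard =
      (openCluster ω x).encard := by
    intro x
    rw [openCluster_relabel_shift v ω x, hinj.encard_image]
  rw [sum_neighborFinset_shift]
  simp only [Set.indicator_apply, Set.mem_setOf_eq, hC, hE]

/-- Incoming mass: `Σ'_a F(a, 0; ω) = |C(0)| h(ω, 0) = Σ_{y ∈ N(0)} T(0, y)`. [folklore] -/
theorem tsum_transport_in (ω : BondConfig (Site d)) :
    ∑' a, (openCluster ω 0).indicator (fun _ => (1 : ℝ≥0∞)) a *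
      ∑ y ∈ (zdGraph d).neighborFinset 0,
        {ω : BondConfig (Site d) | y ∉ openCluster ω 0 ∧
          ((openCluster ω 0).encard : ℝ≥0∞) ≤ (openCluster ω y).encard}.indicator
          (fun _ => (1 : ℝ≥0∞)) ω =
    ∑ y ∈ (zdGraph d).neighborFinset 0,
      {ω : BondConfig (Site d) | y ∉ openCluster ω 0 ∧
          ((openCluster ω 0).encard : ℝ≥0∞) ≤ (openCluster ω y).encard}.indicator
        (fun ω => ((openCluster ω 0).encard : ℝ≥0∞)) ω := by
  classical
  rw [ENNReal.tsum_mul_right]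
  have hcard : ∑' a, (openCluster ω 0).indicator (fun _ => (1 : ℝ≥0∞)) a =
      ((openCluster ω 0).encard : ℝ≥0∞) := by
    rw [← ENNReal.tsum_set_one, ← tsum_subtype (openCluster ω 0) fun _ => (1 : ℝ≥0∞)]
  rw [hcard, Finset.mul_sum]
  refine Finset.sum_congr rfl fun y _ => ?_
  simp only [Set.indicator_apply, Set.mem_setOf_eq, mul_ite, mul_one, mul_zero]

/-- Outgoing mass: `Σ'_b F(0, b; ω) = Σ'_b Σ_{y ∈ N(b)} 1_{A_{b,y}}(ω)` (if `b ∈ C(0)` then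
`C(b) = C(0)`). [folklore] -/
theorem tsum_transport_out (ω : BondConfig (Site d)) :
    ∑' b, (openCluster ω b).indicator (fun _ => (1 : ℝ≥0∞)) 0 *
      ∑ y ∈ (zdGraph d).neighborFinset b,
        {ω : BondConfig (Site d) | y ∉ openCluster ω b ∧
          ((openCluster ω b).encard : ℝ≥0∞) ≤ (openCluster ω y).encard}.indicator
          (fun _ => (1 : ℝ≥0∞)) ω =
    ∑' b, ∑ y ∈ (zdGraph d).neighborFinset b,
      {ω : BondConfig (Site d) | b ∈ openCluster ω 0 ∧ y ∉ openCluster ω 0 ∧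
          ((openCluster ω 0).encard : ℝ≥0∞) ≤ (openCluster ω y).encard}.indicator
          (fun _ => (1 : ℝ≥0∞)) ω := by
  classical
  refine tsum_congr fun b => ?_
  by_cases hb : (0 : Site d) ∈ openCluster ω b
  · have hb' : b ∈ openCluster ω 0 := TwoGhost.mem_openCluster_comm.1 hb
    have hC : openCluster ω b = openCluster ω 0 := TwoGhost.openCluster_eq_of_mem hb'
    rw [Set.indicator_of_mem hb, one_mul]
    refine Finset.sum_congr rfl fun y _ => ?_
    simp only [Set.indicator_apply, Set.mem_setOf_eq, hC, hb', true_and]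
  · have hb' : b ∉ openCluster ω 0 := fun h => hb (TwoGhost.mem_openCluster_comm.1 h)
    rw [Set.indicator_of_notMem hb, zero_mul]
    symm
    refine Finset.sum_eq_zero fun y _ => ?_
    simp only [Set.indicator_apply, Set.mem_setOf_eq, hb', false_and, if_false]

/-- **Step 1 of the item's proof**: for every level `p`,
`m(p) = E_p[Σ_{y ∈ N(0)} 1{0 ↮ y} min(|C(0)|,|C(y)|)] ≤ 2 Σ'_b Σ_{y ∈ N(b)} P_p(A_{b,y})`,
`A_{b,y} = {b ∈ C(0), y ∉ C(0), |C(0)| ≤ |C(y)|}` (kernel bound, reflection, mass transport).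
[folklore] -/
theorem lintegral_minContact_le_tsum (p : unitInterval) :
    ∫⁻ ω, ∑ y ∈ (zdGraph d).neighborFinset (0 : Site d), (openConn (0 : Site d) y)ᶜ.indicator
        (fun ω => min ((openCluster ω 0).encard : ℝ≥0∞) ((openCluster ω y).encard : ℝ≥0∞)) ω
        ∂(bondPercolation (zdGraph d) p) ≤
      2 * ∑' b, ∑ y ∈ (zdGraph d).neighborFinset b, bondPercolation (zdGraph d) p
        {ω : BondConfig (Site d) | b ∈ openCluster ω 0 ∧ y ∉ openCluster ω 0 ∧
          ((openCluster ω 0).encard : ℝ≥0∞) ≤ (openCluster ω y).encard} := by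
  set P := bondPercolation (zdGraph d) p with hP
  -- abbreviations for the kernel, the transport and the swallow-candidate events
  set T : Site d → Site d → BondConfig (Site d) → ℝ≥0∞ := fun x y ω =>
    {ω : BondConfig (Site d) | y ∉ openCluster ω x ∧
      ((openCluster ω x).encard : ℝ≥0∞) ≤ (openCluster ω y).encard}.indicator
      (fun ω => ((openCluster ω x).encard : ℝ≥0∞)) ω with hT
  set F : Site d → Site d → BondConfig (Site d) → ℝ≥0∞ := fun a b ω =>
    (openCluster ω b).indicator (fun _ => (1 : ℝ≥0∞)) a *
      ∑ y ∈ (zdGraph d).neighborFinset b,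
        {ω : BondConfig (Site d) | y ∉ openCluster ω b ∧
          ((openCluster ω b).encard : ℝ≥0∞) ≤ (openCluster ω y).encard}.indicator
          (fun _ => (1 : ℝ≥0∞)) ω with hF
  set A : Site d → Site d → Set (BondConfig (Site d)) := fun b y =>
    {ω : BondConfig (Site d) | b ∈ openCluster ω 0 ∧ y ∉ openCluster ω 0 ∧
      ((openCluster ω 0).encard : ℝ≥0∞) ≤ (openCluster ω y).encard} with hA
  have hTm : ∀ x y, Measurable (T x y) := fun x y =>
    (measurable_encard_openCluster x).indicator (measurableSet_notMem_and_le x y)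
  have hAm : ∀ b y, MeasurableSet (A b y) := fun b y => measurableSet_swallowEvt b y
  -- kernel bound, integrated
  have h1 : ∫⁻ ω, ∑ y ∈ (zdGraph d).neighborFinset (0 : Site d), (openConn (0 : Site d) y)ᶜ.indicator
        (fun ω => min ((openCluster ω 0).encard : ℝ≥0∞) ((openCluster ω y).encard : ℝ≥0∞)) ω ∂P ≤
      ∫⁻ ω, ∑ y ∈ (zdGraph d).neighborFinset (0 : Site d), (T 0 y ω + T y 0 ω) ∂P :=
    lintegral_mono fun ω => Finset.sum_le_sum fun y _ => indicator_min_le_kernel_add ω 0 y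
  refine h1.trans (le_of_eq ?_)
  -- reflection
  have h2 : ∀ y, ∫⁻ ω, (T 0 y ω + T y 0 ω) ∂P = 2 * ∫⁻ ω, T 0 y ω ∂P := by
    intro y
    rw [lintegral_add_left (hTm 0 y), two_mul]
    congr 1
    exact lintegral_kernel_swap p y
  -- mass transport
  have hmtp := lintegral_tsum_mtp p F (fun a b => measurable_transport a b)
    (fun a b v ω => transport_shift a b v ω)
  have hin : ∀ ω, ∑' a, F a 0 ω = ∑ y ∈ (zdGraph d).neighborFinset 0, T 0 y ω := fun ω =>
    tsum_transport_in ω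
  have hout : ∀ ω, ∑' b, F 0 b ω = ∑' b, ∑ y ∈ (zdGraph d).neighborFinset b,
      (A b y).indicator (fun _ => (1 : ℝ≥0∞)) ω := fun ω => tsum_transport_out ω
  simp_rw [hin, hout] at hmtp
  calc ∫⁻ ω, ∑ y ∈ (zdGraph d).neighborFinset (0 : Site d), (T 0 y ω + T y 0 ω) ∂P
      = ∑ y ∈ (zdGraph d).neighborFinset (0 : Site d), ∫⁻ ω, (T 0 y ω + T y 0 ω) ∂P :=
        lintegral_finsetSum _ fun y _ => (hTm 0 y).add (hTm y 0)
    _ = ∑ y ∈ (zdGraph d).neighborFinset (0 : Site d), 2 * ∫⁻ ω, T 0 y ω ∂P :=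
        Finset.sum_congr rfl fun y _ => h2 y
    _ = 2 * ∫⁻ ω, ∑ y ∈ (zdGraph d).neighborFinset (0 : Site d), T 0 y ω ∂P := by
        rw [← Finset.mul_sum, lintegral_finsetSum _ fun y _ => hTm 0 y]
    _ = 2 * ∫⁻ ω, ∑' b, ∑ y ∈ (zdGraph d).neighborFinset b,
          (A b y).indicator (fun _ => (1 : ℝ≥0∞)) ω ∂P := by rw [hmtp]
    _ = 2 * ∑' b, ∫⁻ ω, ∑ y ∈ (zdGraph d).neighborFinset b,
          (A b y).indicator (fun _ => (1 : ℝ≥0∞)) ω ∂P := by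
        rw [lintegral_tsum fun b => (Finset.measurable_sum _ fun y _ =>
          (measurable_const.indicator (hAm b y))).aemeasurable]
    _ = 2 * ∑' b, ∑ y ∈ (zdGraph d).neighborFinset b, P (A b y) := by
        congr 1
        refine tsum_congr fun b => ?_
        rw [lintegral_finsetSum _ fun y _ => measurable_const.indicator (hAm b y)]
        refine Finset.sum_congr rfl fun y _ => ?_
        rw [lintegral_indicator_const (hAm b y), one_mul]

/-- On `A_{b,y}` the edge `s(b, y)` is closed, so `A_{b,y} ⊆ {ω | ω \ {s(b,y)} ∈ A_{b,y}}`. [folklore] -/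
theorem swallowEvt_subset_preimage_diff {V : Type*} [Zero V] (b y : V) :
    {ω : BondConfig V | b ∈ openCluster ω 0 ∧ y ∉ openCluster ω 0 ∧
        ((openCluster ω 0).encard : ℝ≥0∞) ≤ (openCluster ω y).encard} ⊆
      (fun ω : BondConfig V => ω \ {s(b, y)}) ⁻¹'
        {ω : BondConfig V | b ∈ openCluster ω 0 ∧ y ∉ openCluster ω 0 ∧
          ((openCluster ω 0).encard : ℝ≥0∞) ≤ (openCluster ω y).encard} := by
  intro ω hω
  have he : s(b, y) ∉ ω := by
    intro he
    have hby : b ≠ y := fun h => hω.2.1 (h ▸ hω.1)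
    have hadj : (openGraph ω).Adj b y := (openGraph_adj ω b y).2 ⟨he, hby⟩
    exact hω.2.1 (SimpleGraph.Reachable.trans hω.1 hadj.reachable)
  have hdiff : ω \ {s(b, y)} = ω := Set.sdiff_singleton_eq_self he
  simpa only [Set.mem_preimage, hdiff] using hω

end PercMinContactLMC

end Summit.CriticalPhenomena.PercolationContinuityZ3.Theorems

end
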